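import Mathlib
import Summits.Ventures.HodgeRepro.Tier4.Line1.RTFSetting
import Summits.Ventures.HodgeRepro.Tier4.Line4.L1Class
import Summits.Ventures.HodgeRepro.Tier4.Line4.L1ClassWall
import Summits.Ventures.HodgeRepro.Tier4.Line4.L1ClassV3
import Summits.Ventures.HodgeRepro.Tier4.Line4.TailAssembly

/-!
# Tier4/Line4/L1ClassV4 — the §15 v4 generic block of LINE L4 DRAFT v0.34 ((R-27) the FIBRE shape of the tail, (R-25)(b) the
level family's level-uniform and support clauses), ported VERBATIM to the tree

Blind re-derivation cell `pub-hodge-repro`, Tier 4 (README §9–§10), seat t4-L1-p4 (gen 4), cut by t4-plan-4 g4 (S15084: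
«port the generic block L582–L743 VERBATIM to the tree as `Tier4/Line4/L1ClassV4.lean`»).  Target tree path
`lean/Summits/Ventures/HodgeRepro/Tier4/Line4/L1ClassV4.lean`.  APPENDS to L1Class (p699130) / L1ClassWall (p699357) /
L1ClassV3 (p700401), nothing ACCEPTED is edited; the glue `fibreDominated_singleton_of_tailDominated` consumes this seat's
`tsum_eq_add_tsum_ne` (TailAssembly p698331).  Source: HOME proofs/t4-plan-4/Tier4/Line4/Skeleton-v0.34-PREPARED.lean
L582–L743 (eaa4bf5424bda5a9 · 2366), the block's bytes unchanged below this header.  0 print.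

WHAT IS PROVED (8 decls): `FibreDominated` / `FibreDominatedFrom` (the tail in the `J`-form: the fibre sum over a finite
`E` strictly dominates `J − ∑_{o ∈ E} O_o`), `J_ne_zero_of_fibreDominated` (PROVED), `fibreDominated_singleton_of_tailDominated`
(PROVED: the `o₀`-shape `TailDominated` of v0.33 IS the fibre shape with `E = {o₀}` through `RtfGeometricL1`),
`TailFamily'` (the level family with `l1`, `sup₂`, `supp₂`, `suppFin`, `suppFin₂`), `LevelFibreDominated`, `TailForArch''`,
and **`wall_of_L1_data''`** (PROVED: L1ClassV3's wall with the tail step `J_ne_zero_of_fibreDominated`; `hgeo` / `hPc` no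
longer binders).  Nothing here says anything about the status of the Hodge conjecture for CM abelian varieties, which is
NOT proved (HC_CM is NOT proved by anyone in this repository).
-/

set_option autoImplicit false

noncomputable section

open Matrix MeasureTheory NumberField
open scoped ComplexConjugate ComplexOrder Pointwise

namespace Summit.Ventures.HodgeRepro.Tier4.Line4

open Summit.Ventures.HodgeRepro.Tier4

namespace L1Class

open Topology Summit.Ventures.HodgeRepro.Tier4.Common Summit.Ventures.HodgeRepro.Tier4.Line1
  Summit.Ventures.HodgeRepro.Tier4.Line1.RTF

section FibreAbstract

variable {G : Type} [Group G] [TopologicalSpace G] [IsTopologicalGroup G] [MeasurableSpace G] [BorelSpace G]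

/-- **C-L4-TAIL — THE FIBRE SHAPE** ((R-27) S15050): for a FINITE set `E` of rational double cosets (the fibre of the orbit invariant
through `o₀`; `E = {o₀}` under C-L4-ORBSEP), the fibre sum strictly dominates the off-fibre remainder `J − ∑_{o ∈ E} O_o`.  Stated on `J`
directly (x2's TailLayerCake p701949 / L4-p2's TailBound p702085 `norm_J_sub_sum_le` bound exactly this difference), not through the orbit
expansion — so `RtfGeometricL1` is consumed by the PROVERS of (7b), not by the wall.  Not vacuous: `E` must contain `orbitOf γ₀`
(`TailForArch''` below) and the strict inequality forces `∑_{o ∈ E} O_o ≠ 0`. -/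
def FibreDominated (S : Line1.RTF.Setting G) (χ : S.T → ℂ) (χ' : S.T' → ℂ) (E : Finset S.Orbit) (f : G → ℂ) : Prop :=
  ‖S.J χ χ' f - ∑ o ∈ E, S.orbital χ χ' o f‖ < ‖∑ o ∈ E, S.orbital χ χ' o f‖

/-- the level-family form: from some level on, the fibre sum dominates. -/
def FibreDominatedFrom (S : Line1.RTF.Setting G) (χ : S.T → ℂ) (χ' : S.T' → ℂ) (E : Finset S.Orbit)
    (f : ℕ → G → ℂ) : Prop :=
  ∃ N₀ : ℕ, ∀ N ≥ N₀, FibreDominated S χ χ' E (f N)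

omit [IsTopologicalGroup G] [BorelSpace G] in
/-- **FIBRE SHAPE ⇒ `J ≠ 0`** (proved, the triangle inequality): if `J = 0` the remainder IS the fibre sum. -/
theorem J_ne_zero_of_fibreDominated {S : Line1.RTF.Setting G} {χ : S.T → ℂ} {χ' : S.T' → ℂ} {E : Finset S.Orbit}
    {f : G → ℂ} (hT : FibreDominated S χ χ' E f) : S.J χ χ' f ≠ 0 := by
  intro h0
  have h := hT
  rw [FibreDominated, h0, zero_sub, norm_neg] at h
  exact lt_irrefl _ h

omit [IsTopologicalGroup G] [BorelSpace G] in
/-- glue (proved): the `o₀`-shape of v0.33 (`TailDominated`, L1-p4's TailWrapper p701727 proves its level form from (S1)–(S5)) IS the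
fibre shape with `E = {o₀}`, through the orbit expansion `RtfGeometricL1`. -/
theorem fibreDominated_singleton_of_tailDominated {S : Line1.RTF.Setting G} (hgeo : RtfGeometricL1 S)
    {χ : S.T → ℂ} {χ' : S.T' → ℂ} (hχ : S.IsCharacter χ) (hχ' : S.IsCharacter' χ') {f : G → ℂ} (hf : IsTestL1 S f)
    (hP : PoincareSummable S f) {o₀ : S.Orbit} (hT : TailDominated S χ χ' o₀ f) :
    FibreDominated S χ χ' {o₀} f := by
  obtain ⟨hsum, hJ⟩ := hgeo χ χ' hχ hχ' f hf hP
  unfold FibreDominated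
  rw [Finset.sum_singleton, hJ, tsum_eq_add_tsum_ne S hsum o₀, add_sub_cancel_left]
  exact hT.2.2

end FibreAbstract

section FibreArch

open scoped ComplexConjugate

variable {k : Type} [Field k] [NumberField k] (W : PlaneData k) [MeasurableSpace (GA W)] [BorelSpace (GA W)]
  (R : RTFData W) (μ : Measure (GA W)) [μ.IsHaarMeasure] [R.μT.IsHaarMeasure] [R.μT'.IsHaarMeasure]
  (DG : Set (GA W)) (fdG : IsFundamentalDomain (rationalPoints W) DG μ) (compG : IsCompact (closure DG))
  (compT : IsCompact (closure R.DT)) (compT' : IsCompact (closure R.DT'))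

/-- **`TailFamily'` ((R-25)(b), S15032): the level family WITH the level-uniform and support clauses** — an EXTENSION of the ACCEPTED
`TailFamily` (L1Class p699130 L356–L368), never an edit of it.  The natural witness — `ffin N = vol_{μ_f}(K(N))⁻¹ · 1_{γ₀ K(N)}` (`γ₀`
integral with integral inverse normalises `K(N)`, L1-p3's `IsIntegralFin`; `L¹`-norm `1`) and the PRODUCT TEST `f₂ N = finf₂ ⊗ 1_{K(N)}`
(`finf₂` ONE right-`(T′_w, −e′)`-equivariant `C_c` archimedean test, independent of `N`; the finite factor the PLAIN indicator of `K(N)`: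
sup-norm `1`, right-`K(N)`-invariant, support `K(N)`) — meets: `l1` the `L¹` bound of the finite factor uniform in `N` (for EVERY Haar
measure of `G(𝔸_f)`, Haar measures being proportional), `sup₂` the sup bound of `f₂ N` uniform in `N`, `supp₂` one compact carrying
every `tsupport (f₂ N)` (`supp finf₂ × K(1)`), and the two SUPPORT clauses (S1) reads (L3-p2 S15026): `suppFin` — the finite coordinate
of the support of `ffin N` lies in `K(N) γ₀ K(N)`; `suppFin₂` — the finite coordinate of the support of `f₂ N` lies in `K(N)` ITSELF
(not a fixed `K₀`: the congruence then reads `γ_f ∈ t_f K(N) γ₀ K(N) t'_f` directly).  crit-1 Entry 119's MIXED normalisation clause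
`‖ffin N‖_{L¹} · ‖f₂ N‖_∞` is `l1 × sup₂`.  The `L¹` clause is a Bochner integral of a continuous compactly supported function of the
finite coordinate (`IsFinFactor.compact`), hence never a junk value. -/
structure TailFamily' (q : QuadData k) (g g' : Matrix (Fin 4) (Fin 4) k) (eP' eM' : InfinitePlace k → ℤ)
    (γ₀ : GA W) (ffin f₂ : ℕ → GA W → ℂ) : Prop extends TailFamily W q g g' eP' eM' ffin f₂ where
  l1 : ∀ μf : Measure (finitePart W), μf.IsHaarMeasure →
    ∃ M₁ : ℝ, ∀ N, ∫ x : finitePart W, ‖ffin N (x : GA W)‖ ∂μf ≤ M₁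
  sup₂ : ∃ M₂ : ℝ, ∀ N x, ‖f₂ N x‖ ≤ M₂
  supp₂ : ∃ K : Set (GA W), IsCompact K ∧ ∀ N, tsupport (f₂ N) ⊆ K
  suppFin : ∀ N x, ffin N x ≠ 0 →
    ∃ κ₁ ∈ levelK W N, ∃ κ₂ ∈ levelK W N, Line1.GA.ofFinPart W x = κ₁ * Line1.GA.ofFinPart W γ₀ * κ₂
  suppFin₂ : ∀ N x, f₂ N x ≠ 0 → Line1.GA.ofFinPart W x ∈ levelK W N

/-- the level-family fibre shape for the convolution family `(finf ⊗ ffin N) ⋆ f₂ N`. -/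
def LevelFibreDominated (S : Line1.RTF.Setting (GA W)) (χ : S.T → ℂ) (χ' : S.T' → ℂ) (E : Finset S.Orbit)
    (finf : GA W → ℂ) (ffin f₂ : ℕ → GA W → ℂ) : Prop :=
  FibreDominatedFrom S χ χ' E (fun N => S.conv (prodFn W finf (ffin N)) (f₂ N))

/-- **C-L4-TAIL — the display consumed by the wall, v4 (fibre shape over `TailFamily'`)**: for every DECAYING archimedean coefficient at
the RATIONAL `γ₀` there are a level family in `TailFamily'` and a FINITE set `E` of orbits containing `orbitOf γ₀` (the fibre of the
orbit invariant; `{orbitOf γ₀}` under C-L4-ORBSEP) whose fibre sum dominates the off-fibre remainder from some level on, for the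
characters of `R`.  `TailForArch'` (v3, L1ClassV3 p700401) is the case `E = {orbitOf γ₀}` through `fibreDominated_singleton_of_tailDominated`. -/
def TailForArch'' (q : QuadData k) (g g' : Matrix (Fin 4) (Fin 4) k) (w₀ : InfinitePlace k)
    (eP eM eP' eM' : InfinitePlace k → ℤ)
    (γ₀ : (Setting.ofAdelicData W R μ DG fdG compG compT compT').Gk)
    (νinf : Measure (torusInf W)) (νinf' : Measure (torusInf' W)) : Prop :=
  ∀ finf : GA W → ℂ,
    IsArchCoeffD W (Setting.ofAdelicData W R μ DG fdG compG compT compT') R q g g' w₀ eP eM eP' eM' (γ₀ : GA W)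
      νinf νinf' finf →
    ∃ ffin f₂ : ℕ → GA W → ℂ, TailFamily' W q g g' eP' eM' (γ₀ : GA W) ffin f₂ ∧
      ∃ E : Finset (Setting.ofAdelicData W R μ DG fdG compG compT compT').Orbit,
        (Setting.ofAdelicData W R μ DG fdG compG compT compT').orbitOf γ₀ ∈ E ∧
        LevelFibreDominated W (Setting.ofAdelicData W R μ DG fdG compG compT compT') R.chi R.chi' E finf ffin f₂

/-- **THE WALL FROM THE §15 v4 DISPLAYS** (proved, sorry-free): L1ClassV3's `wall_of_L1_data'` with the tail step swapped to the fibre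
shape — `J ≠ 0` at the level `N := max N₀ 1` is `J_ne_zero_of_fibreDominated`; `hgeo` / `hPc` are no longer binders of the wall (they are
consumed inside the proof of (7b)).  Proof = v3's otherwise, through `twoVector_hit_L1'`. -/
theorem wall_of_L1_data'' (hc : Continuous R.chi) (hu : ∀ a, ‖R.chi a‖ = 1)
    (hc' : Continuous R.chi') (hunit' : ∀ t, ‖R.chi' t‖ = 1) (hA : IsAnisotropic W)
    (q : QuadData k) (g g' : Matrix (Fin 4) (Fin 4) k) (w₀ : InfinitePlace k)
    (eP eM eP' eM' : InfinitePlace k → ℤ)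
    (hnorm : ∀ (w : InfinitePlace k) (κ : GA W), κ ∈ localTorusAt' W w →
      ∀ j : Fin 2, ‖weightAt' W q w g g' j κ‖ = 1)
    (D : KTypeData W R q g g' eP eM eP' eM')
    {τ : ℕ → Set (GA W → ℂ)} {φ : ℕ → GA W → ℂ} {n : ℕ → ℕ}
    (hB : (Setting.ofAdelicData W R μ DG fdG compG compT compT').IsAdaptedONB τ φ n)
    (hτcl : ∀ m, IsClosedSub (Setting.ofAdelicData W R μ DG fdG compG compT compT') (τ m))
    (hspec : RtfSpectralL1' (Setting.ofAdelicData W R μ DG fdG compG compT compT'))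
    (hPd : PoincareOfDecay W (Setting.ofAdelicData W R μ DG fdG compG compT compT'))
    (hcl : AdaptedClosedUnderL1 (Setting.ofAdelicData W R μ DG fdG compG compT compT') τ)
    (γ₀ : (Setting.ofAdelicData W R μ DG fdG compG compT compT').Gk)
    (νinf : Measure (torusInf W)) (νinf' : Measure (torusInf' W))
    (hD3 : D3CoeffData' W (Setting.ofAdelicData W R μ DG fdG compG compT compT') R q g g' w₀ eP eM eP' eM'
      (γ₀ : GA W) νinf νinf')
    (htail : TailForArch'' W R μ DG fdG compG compT compT' q g g' w₀ eP eM eP' eM' γ₀ νinf νinf') :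
    ∃ V : Submodule ℂ (GA W → ℂ),
      IsAdmissibleS W (Setting.ofAdelicData W R μ DG fdG compG compT compT') q g g' w₀ eP eM eP' eM' V ∧
      ∃ K : Subgroup (GA W), IsCompactOpenIn W (finitePart W) K ∧
        (∃ f ∈ kTypeSpace' W q g g' eP' eM' K V,
          periodLin W R.μT' R.DT' R.chi' (restrictTo W (torusT' W) f) ≠ 0) ∧
        ∃ f ∈ kTypeSpace' W q g g' eP' eM' K V,
          periodLin W R.μT R.DT R.chi (restrictTo W (torusT W) f) ≠ 0 := by
  set S := Setting.ofAdelicData W R μ DG fdG compG compT compT' with hS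
  obtain ⟨finf, hfinf⟩ := hD3
  obtain ⟨ffin, f₂, hfam', E, _hE, N₀, hN₀⟩ := htail finf hfinf
  have hfam := hfam'.toTailFamily
  set N : ℕ := max N₀ 1 with hNdef
  have hN1 : N ≠ 0 := by
    have : 1 ≤ N := le_max_right _ _
    omega
  have hT := hN₀ N (le_max_left _ _)
  set f₁ : GA W → ℂ := prodFn W finf (ffin N) with hf₁
  have h₁ : IsTestL1 S f₁ :=
    ⟨continuous_prodFn W hfinf.cont (hfam.fin N).cont, hfinf.integrable _ (hfam.fin N)⟩
  have hP₁ : PoincareSummable S f₁ := hPd finf (ffin N) hfinf.cont hfinf.decay (hfam.fin N)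
  have h₂ : IsTestFn W (f₂ N) := hfam.test₂ N
  haveI := secondCountable_GA W
  haveI := sigmaCompact_GA W
  haveI := locallyCompactSpace_GA W
  haveI : SFinite S.μ := inferInstanceAs (SFinite μ)
  have hJ : S.J R.chi R.chi' (S.conv f₁ (f₂ N)) ≠ 0 := J_ne_zero_of_fibreDominated hT
  obtain ⟨j, hhit, hper', hper⟩ :=
    twoVector_hit_L1' W R μ DG fdG compG compT compT' hc hu hc' hunit' hB hspec hcl h₁ hP₁ h₂ hJ
  set K : Subgroup (GA W) := levelK W N with hKdef
  have hK : IsCompactOpenIn W (finitePart W) K := isCompactOpenIn_levelK W hN1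
  have hst₁ := hst₁_L1 W R μ DG fdG compG compT compT' q g g' eP' eM' K hnorm hB hcl h₁
    (fun w κ hκ y => cj_prodFn_equiv W q g g' eP' eM' hfinf.equiv (ffin N) w κ hκ y)
    (fun κ hκ y => cj_prodFn_levelInv W N (hfam.leftInv N) κ hκ y) j
  have hst₂ := hst₂_L1 W R μ DG fdG compG compT compT' q g g' eP' eM' K hnorm hB h₂
    (fun w κ hκ y => refl_equiv W q g g' eP' eM' (hfam.equiv₂ N) w κ hκ y)
    (fun κ hκ y => refl_levelInv W K (hfam.rightInv₂ N) κ hκ y) j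
  refine ⟨Submodule.span ℂ ((fun ψ : GA W → ℂ => fun x => conj (ψ x)) '' τ (n j)), ?_, K, hK,
    ⟨_, hst₂, hper'⟩, ⟨_, hst₁, hper⟩⟩
  exact isAdmissibleS_span_conj_of_periods W R μ DG fdG compG compT compT' hc hu hc' hunit' hA q g g' w₀ eP eM
    eP' eM' D hB (hτcl (n j)) (hfinf.pseudo _ (hfam.fin N)) (hfinf.pseudo' _ (hfam.fin N)) hhit
    (kTypeSpace'_le W q g g' eP' eM' K _ hst₁) hper (kTypeSpace'_le W q g g' eP' eM' K _ hst₂) hper'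

end FibreArch

end L1Class

end Summit.Ventures.HodgeRepro.Tier4.Line4

end
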